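import Literature.NumberTheory.Transcendental.KZLogCalculusProofs
import Literature.NumberTheory.Transcendental.KZRayDilog
import Literature.NumberTheory.Transcendental.KZDominatedFamilyRelations
import Literature.NumberTheory.Transcendental.KZPeriodsProofs

/-!
# `OffTetraSectorKernel` (stmt-KontsevichZagierPeriods-10557), line `odd-hyperbolic-ladder`: stub `stub_bandLogPower`

**THE UNFOLDED PRODUCT RULE, ITERATED: `log (1/t^k) = k · log (1/t)` AS MOVES.** For real `a, b` put
`g(t) = b / ((1 − t a)² + (t b)²)` and, over the base `σ = (0, 1) ⊆ ℝ¹`, consider the bands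
`Band_j = [{0 < t < 1, 1 ≤ u ≤ 1/t^j}, g(t)/u]` (value `j ∫₀¹ g log(1/t)`). Then
`[Band_k] − k • [Band_1] ∈ KZ.relations`: by induction on `j ≤ k`, the intermediate bands `Band_j`
being RESTRICTIONS of `Band_k` (`1/t^j ≤ 1/t^k` on `(0,1)`), each step `[Band_{j+1}] − [Band_j] − [Band_1]`
is ONE unfolded product rule `KZ.of_sub_of_sub_mem_relations_mul` with `u = 1/t^j`, `w = 1/t` (both
`≥ 1` on `σ`; rule (1a), splitting the band at `u = 1/t^j`, and rule (2), the fibrewise substitution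
`u = s/t^j`). No semialgebraicity of `g` is needed (the integrands are only compared on the domains),
so the algebraicity hypotheses on `a, b` of the registered statement are not used.

References: M. Kontsevich, D. Zagier, *Periods* (2001), §1.1 (`log 2 = ∫₁² dx/x`), §1.2, rules (1), (2).
No new definitions.
-/

noncomputable section

open Set MeasureTheory
open Literature.NumberTheory.Transcendental Literature.ModelTheory.ExponentialFields

namespace Summit.KontsevichZagierPeriods.HyperbolicBloch.OffTetraSectorKernel

/-- `t ↦ 1/t^j` is a `ℚ`-semialgebraic function on `(0, 1) ⊆ ℝ¹` (a quotient of polynomials with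
non-vanishing denominator). [cite: KontsevichZagier2001, §1.2] -/
theorem bandLogPower_isSemialgebraicFunOn_one_div_pow (j : ℕ) :
    IsSemialgebraicFunOn ℚ {x : Fin 1 → ℝ | 0 < x 0 ∧ x 0 < 1} (fun x => 1 / x 0 ^ j) := by
  refine (isSemialgebraicFunOn_aeval_div_aeval isSemialgebraic_unitInterval_fin_one 1
    (MvPolynomial.X 0 ^ j : MvPolynomial (Fin 1) ℚ) fun x hx => ?_).congr fun x _ => by simp
  simp only [map_pow, MvPolynomial.aeval_X]
  exact pow_ne_zero _ hx.1.ne'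

/-- The registered band `{0 < t < 1, 1 ≤ u ≤ v t}` written as a `KZlog.band` over `(0, 1) ⊆ ℝ¹`.
[cite: KontsevichZagier2001, §1.2] -/
theorem bandLogPower_setOf_eq_band (v : ℝ → ℝ) :
    {w : Fin 2 → ℝ | (0 < w 0 ∧ w 0 < 1) ∧ 1 ≤ w 1 ∧ w 1 ≤ v (w 0)} =
      KZlog.band {x : Fin 1 → ℝ | 0 < x 0 ∧ x 0 < 1} (fun _ => 1) (fun x => v (x 0)) := by
  ext w
  simp only [mem_setOf_eq, KZlog.band, Fin.init, Fin.castSucc_zero, Fin.last]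
  rfl

/-- **The induction.** With `B = Band_1` and `Bk = Band_k` given (bands over `(0,1)` with fibres
`1 ≤ u ≤ 1/t`, `1 ≤ u ≤ 1/t^k` and integrand `g(t)/u` on them): for every `1 ≤ j ≤ k` and every
representation `N` with domain the band `{1 ≤ u ≤ 1/t^j}` and integrand `g(t)/u` on it,
`[N] − j • [B] ∈ KZ.relations` — the case `j = 1` is congruence, the step is the unfolded product rule
`KZ.of_sub_of_sub_mem_relations_mul` (`1/t^{j+1} = (1/t^j) · (1/t)`) applied to `N`, the restriction of
`Bk` to the band `{1 ≤ u ≤ 1/t^j}`, and `B`. [cite: KontsevichZagier2001, §1.2] -/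
theorem bandLogPower_aux (a b : ℝ) (k : ℕ) (Bk B : KZ.IntegralRep 2)
    (hBkd : Bk.domain =
      KZlog.band {x : Fin 1 → ℝ | 0 < x 0 ∧ x 0 < 1} (fun _ => 1) (fun x => 1 / x 0 ^ k))
    (hBki : EqOn Bk.integrand (fun w => b / ((1 - w 0 * a) ^ 2 + (w 0 * b) ^ 2) / w 1) Bk.domain)
    (hBd : B.domain = KZlog.band {x : Fin 1 → ℝ | 0 < x 0 ∧ x 0 < 1} (fun _ => 1) (fun x => 1 / x 0))
    (hBi : EqOn B.integrand (fun w => b / ((1 - w 0 * a) ^ 2 + (w 0 * b) ^ 2) / w 1) B.domain) :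
    ∀ j, 1 ≤ j → j ≤ k → ∀ N : KZ.IntegralRep 2,
      N.domain = KZlog.band {x : Fin 1 → ℝ | 0 < x 0 ∧ x 0 < 1} (fun _ => 1) (fun x => 1 / x 0 ^ j) →
      EqOn N.integrand (fun w => b / ((1 - w 0 * a) ^ 2 + (w 0 * b) ^ 2) / w 1) N.domain →
      KZ.of N - j • KZ.of B ∈ KZ.relations := by
  intro j hj
  induction j, hj using Nat.le_induction with
  | base =>
    intro _ N hNd hNi
    rw [one_nsmul]
    have hd : B.domain = N.domain :=
      hBd.trans (hNd.trans (KZlog.band_congr fun x _ => by simp)).symm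
    exact KZ.of_sub_of_mem_relations_of_eqOn hd fun z hz => by rw [hNi hz, hBi (hd.symm ▸ hz)]
  | succ j hj ih =>
    intro hjk N hNd hNi
    have hσ : IsSemialgebraic ℚ {x : Fin 1 → ℝ | 0 < x 0 ∧ x 0 < 1} :=
      isSemialgebraic_unitInterval_fin_one
    have hu := bandLogPower_isSemialgebraicFunOn_one_div_pow j
    have hw : IsSemialgebraicFunOn ℚ {x : Fin 1 → ℝ | 0 < x 0 ∧ x 0 < 1} (fun x => 1 / x 0) :=
      (bandLogPower_isSemialgebraicFunOn_one_div_pow 1).congr fun x _ => by simp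
    have hc1 : IsSemialgebraicFunOn ℚ {x : Fin 1 → ℝ | 0 < x 0 ∧ x 0 < 1} (fun _ => (1 : ℝ)) := by
      simpa using isSemialgebraicFunOn_ratCast hσ 1
    have hu1 : ∀ x ∈ {x : Fin 1 → ℝ | 0 < x 0 ∧ x 0 < 1}, 1 ≤ 1 / x 0 ^ j := fun x hx =>
      one_le_one_div (pow_pos hx.1 j) (pow_le_one₀ hx.1.le hx.2.le)
    have hw1 : ∀ x ∈ {x : Fin 1 → ℝ | 0 < x 0 ∧ x 0 < 1}, 1 ≤ 1 / x 0 := fun x hx =>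
      one_le_one_div hx.1 hx.2.le
    -- the intermediate band `Band_j`, a restriction of `Bk`
    have hS : IsSemialgebraic ℚ
        (KZlog.band {x : Fin 1 → ℝ | 0 < x 0 ∧ x 0 < 1} (fun _ => 1) (fun x => 1 / x 0 ^ j)) :=
      KZlog.isSemialgebraic_band hc1 hu
    have hsub : KZlog.band {x : Fin 1 → ℝ | 0 < x 0 ∧ x 0 < 1} (fun _ => 1) (fun x => 1 / x 0 ^ j) ⊆
        Bk.domain := by
      rw [hBkd]
      rintro z ⟨hz, h1, h2⟩
      exact ⟨hz, h1, h2.trans (one_div_le_one_div_of_le (pow_pos hz.1 _)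
        (pow_le_pow_of_le_one hz.1.le hz.2.le (by omega)))⟩
    set Nj := Bk.restrict _ hS hsub with hNj
    have hNjd : Nj.domain =
        KZlog.band {x : Fin 1 → ℝ | 0 < x 0 ∧ x 0 < 1} (fun _ => 1) (fun x => 1 / x 0 ^ j) := by
      rw [hNj, KZ.IntegralRep.domain_restrict]
    have hNji : EqOn Nj.integrand (fun w => b / ((1 - w 0 * a) ^ 2 + (w 0 * b) ^ 2) / w 1)
        Nj.domain := fun z hz => by
      rw [hNj, KZ.IntegralRep.integrand_restrict, hBki (hsub (hNjd ▸ hz))]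
    have hih : KZ.of Nj - j • KZ.of B ∈ KZ.relations := ih (by omega) Nj hNjd hNji
    -- ONE unfolded product rule: `1/t^(j+1) = (1/t^j) · (1/t)`
    have hmul : KZ.of N - KZ.of Nj - KZ.of B ∈ KZ.relations :=
      KZ.of_sub_of_sub_mem_relations_mul (m := 1)
        (g := fun x : Fin 1 → ℝ => b / ((1 - x 0 * a) ^ 2 + (x 0 * b) ^ 2)) hσ hu hw hu1 hw1 N Nj B
        (hNd.trans (KZlog.band_congr fun x _ => by
          show 1 / x 0 ^ (j + 1) = 1 / x 0 ^ j * (1 / x 0)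
          rw [pow_succ, one_div_mul_one_div]))
        hNi hNjd hNji hBd hBi
    have : KZ.of N - (j + 1) • KZ.of B =
        (KZ.of N - KZ.of Nj - KZ.of B) + (KZ.of Nj - j • KZ.of B) := by
      rw [succ_nsmul]
      abel
    rw [this]
    exact KZ.relations.add_mem hmul hih

/-- STUB `stub_bandLogPower` (the unfolded product rule, iterated: `log(1/t^k) = k log(1/t)`): the band with fibre bound
`1/t^k` and integrand `g(t)/u` is `k` times the band with fibre bound `1/t`: induction on `k` with
`KZ.of_sub_of_sub_mem_relations_mul` (`u := 1/t^k`, `w := 1/t`, both `≥ 1` on `(0,1)`), the intermediate bands being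
RESTRICTIONS of the given one (`KZ.IntegralRep.restrict`, `1/t^j ≤ 1/t^k` on `(0,1)` for `j ≤ k`).
[cite: KontsevichZagier2001, §1.2] -/
theorem stub_bandLogPower :
    ∀ (k : ℕ), 1 ≤ k → ∀ (a b : ℝ), IsAlgebraic ℚ a → IsAlgebraic ℚ b →
    ∀ (Bk B : KZ.IntegralRep 2),
      Bk.domain = {w | (0 < w 0 ∧ w 0 < 1) ∧ 1 ≤ w 1 ∧ w 1 ≤ 1 / w 0 ^ k} →
      Set.EqOn Bk.integrand (fun w => b / ((1 - w 0 * a) ^ 2 + (w 0 * b) ^ 2) / w 1) Bk.domain →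
      B.domain = {w | (0 < w 0 ∧ w 0 < 1) ∧ 1 ≤ w 1 ∧ w 1 ≤ 1 / w 0} →
      Set.EqOn B.integrand (fun w => b / ((1 - w 0 * a) ^ 2 + (w 0 * b) ^ 2) / w 1) B.domain →
      KZ.of Bk - k • KZ.of B ∈ KZ.relations := by
  intro k hk a b _ _ Bk B hBkd hBki hBd hBi
  have hBkd' : Bk.domain =
      KZlog.band {x : Fin 1 → ℝ | 0 < x 0 ∧ x 0 < 1} (fun _ => 1) (fun x => 1 / x 0 ^ k) :=
    hBkd.trans (bandLogPower_setOf_eq_band fun t => 1 / t ^ k)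
  have hBd' : B.domain =
      KZlog.band {x : Fin 1 → ℝ | 0 < x 0 ∧ x 0 < 1} (fun _ => 1) (fun x => 1 / x 0) :=
    hBd.trans (bandLogPower_setOf_eq_band fun t => 1 / t)
  exact bandLogPower_aux a b k Bk B hBkd' hBki hBd' hBi k hk le_rfl Bk hBkd' hBki

end Summit.KontsevichZagierPeriods.HyperbolicBloch.OffTetraSectorKernel

end
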